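import Literature.MathematicalPhysics.QuantumFieldTheory.Balaban1983to89.Node00.BackgroundActionT
import Literature.MathematicalPhysics.QuantumFieldTheory.Balaban1983to89.B11Thm1LevelZero

/-!
# Node00 / ZeroInputStepT — the ONE-STEP OUTPUT FUNCTIONAL with explicit input action, its ZERO-INPUT value 𝓝⁰_{k+1}, and the history channel

[Balaban1987RG1] = [I] (CMP 109, 1987): (0.17)–(0.19) p. 255, (0.21)–(0.22) p. 256, (1.3) p. 260, (1.6) p. 261, (1.20)–(1.22) p. 264;
[Balaban1988RG2Cluster] = [II] (CMP 116, 1988): (1.4)–(1.6) p. 3, p. 21 (the two-term bookkeeping «terms from log Z^{(k)} … absolute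
constant … define ½E₀ as equal to this constant» ∕ «O(1)C₃ε₁ ≤ ½E₀»).

WHAT THIS FILE IS.  Definitions over the transport-generic layer `Node00.BackgroundActionT` (every object below is a twin of an object
there, over the SAME generic block transport `T`, characteristic functions `χ`, regularity radius `ε`, torus index `K`, couplings `g`):
* `mainTermT` — print's MAIN TERM `A⁰_k := −(1∕g_k²) A(U_k(V))` of the level-`k` effective action ([I] (1.3)) as a level-`k` density (K-generic;
  `Node00.wilsonBGOfRecord` fixes `p.K`);  `EkT` — `𝐄_k := A_k + (1∕g_k²) A(U_k)` ((0.22) as a definition; K-generic twin of `EkOfRecordT`),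
  so that `A_k = A⁰_k + 𝐄_k` is THE TREE's (0.22) split (`effActionHT_eq_main_add_Ek`, `ring`);
* `stepOutT` — the one-step functional of record with EXPLICIT input action,
  `R_k(A)(W) := log[(T_k χ_k e^{−GF∕g_k² + A})(W) ∕ 𝐍_k(A)] − A(Ū^k U_{k+1} W)` = (0.19) followed by the subtraction of (1.6);
  `Node00.mergedTermT … = stepOutT … (effActionHT …)` is `rfl` (`mergedTermT_eq_stepOut`);
* `zeroInputMergedTermT` — **𝓝⁰_{k+1} := R_k(A⁰_k)**, the ZERO-INPUT one-step output: (1.6) with the accumulated small actions 𝐄_k switched off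
  (VERBATIM `mergedTermT` with `effActionHT … k` replaced by `mainTermT … k` in both places; `= stepOutT … (mainTermT …)` by `rfl`), with its
  β-layer ∕ matrix-carrier exports `zeroInputMergedTermFamilyT` ∕ `zeroInputMergedTermFamilyMatT` (mirrors of `mergedTermFamilyT` ∕
  `mergedTermFamilyMatT`, the species the record-side θ-route wrapper `recordΦf` consumes — its zero-input twin `recordΦf⁰` swaps this one constant);
* the kernel identities: `dChannel_eq` — the HISTORY CHANNEL 𝓓_{k+1} := 𝓝_{k+1} − 𝓝⁰_{k+1} = [𝐓_k(A_k) − 𝐓_k(A⁰_k)](W) − 𝐄_k(Ū^k U_{k+1} W)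
  («response of the one-step map (0.19) to the input 𝐄_k, minus 𝐄_k transported to the new background» — print's (1.6) structure; [II] (1.4)–(1.6));
  `mergedTermT_eq_stepOut_hist` — 𝓝 = R_k(A⁰_k + 𝐄_k) and 𝓝⁰ = R_k(A⁰_k + 0) for the SAME `R_k`, so `𝓝 − 𝓝⁰` is homogeneous in the history
  BY CONSTRUCTION (every history-free term of the step lands in 𝓝⁰ automatically; no hand-picked list of «main terms» enters);
  `nextAction_congr_support` — (0.19) reads its input action only on `supp χ_k`;
* the first level (by the tree's `B11Thm1LevelZero.Uk_zero_eq`: `U_0(V) = V` on the regularity class — (0.21) at k = 0), whence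
  `dChannel_zero_at_first_level'`: 𝓝_1 = 𝓝⁰_1 as soon as `supp χ_0 ⊆ bgReg_0` and `U_1(W) ∈ bgReg_0` (no history at the first step, (0.17)).

PROVENANCE.  These are the bytes of the NODE-O cell's lens seat `ymgap-nodeO-lens-2` g4 (planner-ymgap-nodeO-lens-2-g4-0), K2∕K1″ pre-check
`LENS-2-DN0-precheck-v3.lean` sha16 fc820c496e1f006b (= crux workfile `Summits/…/Cruxes/Record13SepCoPHInhabited/Lens2G4ZeroInputTermDefs.lean`,
2026-08-30), kernel-re-checked by the critic of record ym-nodeO-crit-1 g32 (HOME STATUS l.3551: condition K1″ «met in kernel»), RE-HOMED VERBATIM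
into Literature by the print-typer seat `ymgap-nodeO-typer-1` g2 under the sub-namespace `…Node00.ZeroInput` (so that the crux workfiles, which
`open …Node00` and declare the same short names in their own namespace, keep elaborating).  Used by: the port item
`stmt-QuantumFields-26648` `PortZeroInputSplitZD` (the (Z) zero-input format ∕ (L) history-channel contraction split of the (1.18)-format wall,
[II] p. 21), whose text reads the record's `recordΦf⁰` = `recordΦf` with `mergedTermFamilyMatT ↦ ZeroInput.zeroInputMergedTermFamilyMatT`.

HONEST FRAMING.  Definitions of record re-issued with one input switched off + kernel-checked bookkeeping (`rfl`, `ring`, `linarith`);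
NOTHING of Bałaban's estimates is asserted, ported or discharged; no named fact is introduced; the item 26648 and the wall item 27930 stay
OPEN statements; stub 2′ ∕ K0⁷ OPEN; counts unmoved; finite 𝕋⁴ at fixed ε — NOT continuum ∕ OS ∕ Clay; the Yang–Mills mass gap is NOT
proved by any of this.  No `sorry`, no `instance`, no `notation`, no new axiom.
-/

noncomputable section

namespace Literature.MathematicalPhysics.QuantumFieldTheory.Balaban1983to89.Node00.ZeroInput

open B12Eq019ActionBody (nextAction wilsonTerm)
open T4Continuum (T4Family)
open T4FlagMemory (extd)

variable (F : T4Family) (N : ℕ) [NeZero N]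

/-! ## §1. The main term, 𝐄_k, the zero-input output 𝓝⁰ and the history channel -/

/-- Print's MAIN TERM `A⁰_k := −(1∕g_k²) A(U_k(V))` of the effective action at level `k` ([I] (1.3) p. 260), over the background of record `Uk`
and the `d = 4` Wilson action `wilsonAction4`; K-generic (cf. `Node00.wilsonBGOfRecord`, which fixes `p.K`).  JUNK NOTE: at `g k = 0` Mathlib's
`1 ∕ 0 = 0` makes it vanish — a junk value off every in-interval run, as for `EkOfRecordT`. [cite: Balaban1987RG1, (1.3) p.260] -/
def mainTermT (ε : ℝ) (K : ℕ) (g : ℕ → ℝ) (k : ℕ) : Density (F.P K) k (SU N) :=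
  fun V => -(1 / (g k) ^ 2) * wilsonAction4 (Uk F N K k ε V)

/-- `𝐄_k` over a generic transport, K-generic: `A_k + (1∕g_k²) A(U_k)` ((0.22) as a definition; twin of `Node00.EkOfRecordT`).
[cite: Balaban1987RG1, (0.22) p.256] -/
def EkT (T : Transport F N) (χ : (K : ℕ) → (ℕ → ℝ) → (k : ℕ) → Density (F.P K) k (SU N)) (ε : ℝ) (K : ℕ) (g : ℕ → ℝ) (k : ℕ)
    (V : GaugeField (F.P K) k (SU N)) : ℝ :=
  effActionHT F N T χ K g k V + (1 / (g k) ^ 2) * wilsonAction4 (Uk F N K k ε V)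

/-- `A_k = A⁰_k + 𝐄_k` pointwise — THE TREE's (0.22) split (definition chasing). [cite: Balaban1987RG1, (0.22) p.256, (1.3) p.260 (bookkeeping)] -/
theorem effActionHT_eq_main_add_Ek (T : Transport F N) (χ : (K : ℕ) → (ℕ → ℝ) → (k : ℕ) → Density (F.P K) k (SU N)) (ε : ℝ)
    (K : ℕ) (g : ℕ → ℝ) (k : ℕ) (V : GaugeField (F.P K) k (SU N)) :
    effActionHT F N T χ K g k V = mainTermT F N ε K g k V + EkT F N T χ ε K g k V := by
  unfold mainTermT EkT; ring

/-- **D𝓝⁰ — the ZERO-INPUT one-step output** `𝓝⁰_{k+1}(W) := log[(T_k χ_k e^{−GF∕g_k² + A⁰_k})(W) ∕ 𝐍⁰_k] − A⁰_k(Ū^k U_{k+1} W)`: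
(1.6) with 𝐄_k switched off — VERBATIM `Node00.mergedTermT` with `effActionHT … k` replaced by `mainTermT … k` in both places.
[cite: Balaban1987RG1, (1.6) p.261, (0.19) p.255] -/
def zeroInputMergedTermT (T : Transport F N) (χ : (K : ℕ) → (ℕ → ℝ) → (k : ℕ) → Density (F.P K) k (SU N)) (ε : ℝ) (K : ℕ)
    (g : ℕ → ℝ) (k : ℕ) (W : GaugeField (F.P K) (k + 1) (SU N)) : ℝ :=
  nextAction (T K k) (χ K g k) (gfOfRecord F N K k) (g k) (mainTermT F N ε K g k) W
    - mainTermT F N ε K g k (Averaging.iter (avOfRecord F N K) k (Uk F N K (k + 1) ε W))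

/-- β-layer export of 𝓝⁰ (mirror of `Node00.mergedTermFamilyT`): history `hist` read through `extd`, fields read through `r : 𝔄 → SU(N)`.
[cite: Balaban1987RG1, (1.20)–(1.22) p.264] -/
def zeroInputMergedTermFamilyT (T : Transport F N) (χ : (K : ℕ) → (ℕ → ℝ) → (k : ℕ) → Density (F.P K) k (SU N)) (ε : ℝ)
    {𝔄 : Type*} (r : 𝔄 → SU N) :
    (k : ℕ) → (Fin (k + 1) → ℝ) → (K : ℕ) → ((Fin (F.P K).d → Site (F.P K) (k + 1) → 𝔄) → ℝ) :=
  fun k hist K W => zeroInputMergedTermT F N T χ ε K (extd hist) k (readField F N r W)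

/-- Matrix-carrier export of 𝓝⁰ (mirror of `Node00.mergedTermFamilyMatT`; the species the record-side θ-route wrapper consumes — the record's
`recordΦf⁰` is `recordΦf` with exactly this constant swapped for `mergedTermFamilyMatT`). [cite: Balaban1987RG1, (1.20) p.264] -/
def zeroInputMergedTermFamilyMatT (T : Transport F N) (χ : (K : ℕ) → (ℕ → ℝ) → (k : ℕ) → Density (F.P K) k (SU N)) (ε : ℝ) :
    (k : ℕ) → (Fin (k + 1) → ℝ) → (K : ℕ) → ((Fin (F.P K).d → Site (F.P K) (k + 1) → Matrix (Fin N) (Fin N) ℂ) → ℝ) :=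
  zeroInputMergedTermFamilyT F N T χ ε (suOfMat N)

/-- **The HISTORY CHANNEL, kernel identity.** `𝓓_{k+1}(W) := 𝓝_{k+1}(W) − 𝓝⁰_{k+1}(W) = [𝐓_k(A_k)(W) − 𝐓_k(A⁰_k)(W)] − 𝐄_k(Ū^k U_{k+1} W)`:
the response of the one-step map (0.19) to the input 𝐄_k, minus 𝐄_k transported to the new background — by `effActionHT_succ` (`rfl`) and `ring`.
[cite: Balaban1987RG1, (1.6) p.261 (bookkeeping)] -/
theorem dChannel_eq (T : Transport F N) (χ : (K : ℕ) → (ℕ → ℝ) → (k : ℕ) → Density (F.P K) k (SU N)) (ε : ℝ) (K : ℕ)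
    (g : ℕ → ℝ) (k : ℕ) (W : GaugeField (F.P K) (k + 1) (SU N)) :
    mergedTermT F N T χ ε K g k W - zeroInputMergedTermT F N T χ ε K g k W =
      (nextAction (T K k) (χ K g k) (gfOfRecord F N K k) (g k) (effActionHT F N T χ K g k) W
        - nextAction (T K k) (χ K g k) (gfOfRecord F N K k) (g k) (mainTermT F N ε K g k) W)
      - EkT F N T χ ε K g k (Averaging.iter (avOfRecord F N K) k (Uk F N K (k + 1) ε W)) := by
  unfold mergedTermT zeroInputMergedTermT EkT mainTermT
  rw [effActionHT_succ]
  ring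

/-- (B0)-shape at the first level: `A_0 = wilsonTerm (g 0) 1` (tree, `rfl`) and the main term at level 0 agree on every `V` with `Uk F N K 0 ε V = V`
(the background of a level-0 field in the regularity class is itself — the tree's `B11Thm1LevelZero.Uk_zero_eq`). [cite: Balaban1987RG1, (0.17) p.255 (bookkeeping)] -/
theorem mainTermT_zero_of_Uk_id (T : Transport F N) (χ : (K : ℕ) → (ℕ → ℝ) → (k : ℕ) → Density (F.P K) k (SU N)) (ε : ℝ) (K : ℕ)
    (g : ℕ → ℝ) (V : GaugeField (F.P K) 0 (SU N)) (hU : Uk F N K 0 ε V = V) :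
    mainTermT F N ε K g 0 V = effActionHT F N T χ K g 0 V := by
  rw [effActionHT_zero]
  simp [mainTermT, hU, wilsonAction4]

/-- … equivalently `𝐄_0` vanishes there. [cite: Balaban1987RG1, (0.17) p.255 (bookkeeping)] -/
theorem EkT_zero_of_Uk_id (T : Transport F N) (χ : (K : ℕ) → (ℕ → ℝ) → (k : ℕ) → Density (F.P K) k (SU N)) (ε : ℝ) (K : ℕ)
    (g : ℕ → ℝ) (V : GaugeField (F.P K) 0 (SU N)) (hU : Uk F N K 0 ε V = V) :
    EkT F N T χ ε K g 0 V = 0 := by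
  have h := effActionHT_eq_main_add_Ek F N T χ ε K g 0 V
  rw [mainTermT_zero_of_Uk_id F N T χ ε K g V hU] at h
  linarith

/-! ## §2. ONE named one-step functional `stepOutT` with the level-`k` INPUT ACTION explicit; 𝓝 and 𝓝⁰ are its values at `A_k` resp.
`A⁰_k` (the tree's own (0.22) split), both by `rfl` — the critic's condition K1″ (NODE-O cell, HOME STATUS l.3536 ∕ l.3551): `𝓝 − 𝓝⁰ =
R(A⁰_k + 𝐄_k) − R(A⁰_k)` is homogeneous in the input BY CONSTRUCTION, so every history-free activity of [II] (2.14) (P-terms, localisation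
terms) lands in 𝓝⁰ automatically. -/

/-- **The one-step functional of record with EXPLICIT input action** `R_k(A)(W) := log[(T_k χ_k e^{−GF∕g_k² + A})(W) ∕ 𝐍_k(A)] − A(Ū^k U_{k+1} W)`
= (0.19) followed by the subtraction of (1.6), as a function of the level-`k` action `A`. [cite: Balaban1987RG1, (0.19) p.255, (1.6) p.261] -/
def stepOutT (T : Transport F N) (χ : (K : ℕ) → (ℕ → ℝ) → (k : ℕ) → Density (F.P K) k (SU N)) (ε : ℝ) (K : ℕ) (g : ℕ → ℝ) (k : ℕ)
    (A : Density (F.P K) k (SU N)) (W : GaugeField (F.P K) (k + 1) (SU N)) : ℝ :=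
  nextAction (T K k) (χ K g k) (gfOfRecord F N K k) (g k) A W - A (Averaging.iter (avOfRecord F N K) k (Uk F N K (k + 1) ε W))

/-- `𝓝_{k+1} = R_k(A_k)` — `rfl` (with `effActionHT_succ`). [cite: Balaban1987RG1, (1.6) p.261 (bookkeeping)] -/
theorem mergedTermT_eq_stepOut (T : Transport F N) (χ : (K : ℕ) → (ℕ → ℝ) → (k : ℕ) → Density (F.P K) k (SU N)) (ε : ℝ) (K : ℕ)
    (g : ℕ → ℝ) (k : ℕ) (W : GaugeField (F.P K) (k + 1) (SU N)) :
    mergedTermT F N T χ ε K g k W = stepOutT F N T χ ε K g k (effActionHT F N T χ K g k) W := rfl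

/-- `𝓝⁰_{k+1} = R_k(A⁰_k)` — `rfl`. [cite: Balaban1987RG1, (1.6) p.261 (bookkeeping)] -/
theorem zeroInputMergedTermT_eq_stepOut (T : Transport F N) (χ : (K : ℕ) → (ℕ → ℝ) → (k : ℕ) → Density (F.P K) k (SU N)) (ε : ℝ)
    (K : ℕ) (g : ℕ → ℝ) (k : ℕ) (W : GaugeField (F.P K) (k + 1) (SU N)) :
    zeroInputMergedTermT F N T χ ε K g k W = stepOutT F N T χ ε K g k (mainTermT F N ε K g k) W := rfl

/-- The input split is the TREE's (0.22): `A_k = A⁰_k + 𝐄_k` as densities (so `𝓝 = R(A⁰ + 𝐄_k)`, `𝓝⁰ = R(A⁰ + 0)`).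
[cite: Balaban1987RG1, (0.22) p.256 (bookkeeping)] -/
theorem effActionHT_eq_main_add_Ek_fun (T : Transport F N) (χ : (K : ℕ) → (ℕ → ℝ) → (k : ℕ) → Density (F.P K) k (SU N)) (ε : ℝ)
    (K : ℕ) (g : ℕ → ℝ) (k : ℕ) :
    effActionHT F N T χ K g k = mainTermT F N ε K g k + EkT F N T χ ε K g k := by
  funext V; exact effActionHT_eq_main_add_Ek F N T χ ε K g k V

/-- `𝓝` as the step functional at history `h := 𝐄_k` and `𝓝⁰` at history `0`, for the SAME `R_k(A⁰_k + ·)` — K1″'s two displayed identities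
(the first by the (0.22) split, the second by `add_zero`). [cite: Balaban1987RG1, (1.6) p.261 (bookkeeping)] -/
theorem mergedTermT_eq_stepOut_hist (T : Transport F N) (χ : (K : ℕ) → (ℕ → ℝ) → (k : ℕ) → Density (F.P K) k (SU N)) (ε : ℝ) (K : ℕ)
    (g : ℕ → ℝ) (k : ℕ) (W : GaugeField (F.P K) (k + 1) (SU N)) :
    mergedTermT F N T χ ε K g k W = stepOutT F N T χ ε K g k (mainTermT F N ε K g k + EkT F N T χ ε K g k) W ∧
    zeroInputMergedTermT F N T χ ε K g k W = stepOutT F N T χ ε K g k (mainTermT F N ε K g k + 0) W := by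
  refine ⟨?_, by rw [add_zero]; rfl⟩
  rw [mergedTermT_eq_stepOut, effActionHT_eq_main_add_Ek_fun F N T χ ε K g k]

/-- The one-step map (0.19) reads its input action only on the support of `χ_k`: two inputs that agree wherever `χ_k ≠ 0` give the same
`𝐓_k`-image (the integrand carries the factor `χ_k(U)`). [cite: Balaban1987RG1, (0.19) p.255 (bookkeeping)] -/
theorem nextAction_congr_support {P : Params} {G : Type*} [GaugeGroup G] {k : ℕ} (T : Density P k G → Density P (k + 1) G)
    (χ GF : Density P k G) (gk : ℝ) (A A' : Density P k G) (h : ∀ U, χ U ≠ 0 → A U = A' U) :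
    nextAction T χ GF gk A = nextAction T χ GF gk A' := by
  have hI : B12Eq019ActionBody.integrand χ GF gk A = B12Eq019ActionBody.integrand χ GF gk A' := by
    funext U
    by_cases hχ : χ U = 0
    · simp [B12Eq019ActionBody.integrand, hχ]
    · simp [B12Eq019ActionBody.integrand, h U hχ]
  unfold nextAction B12Eq019ActionBody.normConst
  rw [hI]

/-- At the first level the history channel VANISHES — `𝓝_1 = 𝓝⁰_1` — as soon as (i) the background of a level-0 field in the support of `χ_0`
is the field itself and (ii) the same holds at the 0-fold average of the new background `U_1(W)` (both instances of «`U_0(V) = V`», (0.21) at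
k = 0). [cite: Balaban1987RG1, (0.17) p.255, (0.21) p.256 (bookkeeping)] -/
theorem dChannel_zero_at_first_level (T : Transport F N) (χ : (K : ℕ) → (ℕ → ℝ) → (k : ℕ) → Density (F.P K) k (SU N)) (ε : ℝ)
    (K : ℕ) (g : ℕ → ℝ) (W : GaugeField (F.P K) 1 (SU N))
    (h₁ : ∀ V : GaugeField (F.P K) 0 (SU N), χ K g 0 V ≠ 0 → Uk F N K 0 ε V = V)
    (h₂ : Uk F N K 0 ε (Averaging.iter (avOfRecord F N K) 0 (Uk F N K 1 ε W)) = Averaging.iter (avOfRecord F N K) 0 (Uk F N K 1 ε W)) :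
    mergedTermT F N T χ ε K g 0 W = zeroInputMergedTermT F N T χ ε K g 0 W := by
  have hA : nextAction (T K 0) (χ K g 0) (gfOfRecord F N K 0) (g 0) (effActionHT F N T χ K g 0) =
      nextAction (T K 0) (χ K g 0) (gfOfRecord F N K 0) (g 0) (mainTermT F N ε K g 0) :=
    nextAction_congr_support _ _ _ _ _ _ fun V hV => (mainTermT_zero_of_Uk_id F N T χ ε K g V (h₁ V hV)).symm
  have hE := EkT_zero_of_Uk_id F N T χ ε K g (Averaging.iter (avOfRecord F N K) 0 (Uk F N K 1 ε W)) h₂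
  have hD := dChannel_eq F N T χ ε K g 0 W
  rw [hA, hE, sub_self, sub_zero] at hD
  linarith

/-! ## §3. The two `Uk` leaves of the first-level identity, reduced BY NAME: at level 0 the background of record of a REGULAR field is the field
itself — the tree's `B11Thm1LevelZero.Uk_zero_eq` (`U_0(V) = V` for `V ∈ bgReg_0`; with `ukExists_zero_iff`, `uniqueUkOrbit_zero` there) — so
(h₁) = «supp χ_0 ⊆ bgReg_0» and (h₂) = «U_1(W) ∈ bgReg_0» (true near `W = 1`: `bgReg` is an open plaquette condition and `U_1(1) = 1`;
continuity of the minimiser is [Balaban1985Variational] content, not used here). -/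

/-- The first-level identity in its FINAL form: `𝓝_1(W) = 𝓝⁰_1(W)` whenever `supp χ_0 ⊆ bgReg_0` (the small-field characteristic function of
record lives inside the plaquette-regularity class — [I] (0.8) ∕ (1.2)) and the new background `U_1(W)` is level-0-regular (true on a
neighbourhood of `W = 1`); the `Uk` leaves are the tree's `B11Thm1LevelZero.Uk_zero_eq`.
[cite: Balaban1987RG1, (0.17) p.255, (0.21) p.256, (1.2) p.260 (bookkeeping)] -/
theorem dChannel_zero_at_first_level' (T : Transport F N) (χ : (K : ℕ) → (ℕ → ℝ) → (k : ℕ) → Density (F.P K) k (SU N)) (ε : ℝ)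
    (K : ℕ) (g : ℕ → ℝ) (W : GaugeField (F.P K) 1 (SU N))
    (hχ : ∀ V : GaugeField (F.P K) 0 (SU N), χ K g 0 V ≠ 0 → V ∈ bgReg F N K 0 ε)
    (hW : Uk F N K 1 ε W ∈ bgReg F N K 0 ε) :
    mergedTermT F N T χ ε K g 0 W = zeroInputMergedTermT F N T χ ε K g 0 W :=
  dChannel_zero_at_first_level F N T χ ε K g W (fun V hV => B11Thm1LevelZero.Uk_zero_eq (F := F) (N := N) (hχ V hV))
    (B11Thm1LevelZero.Uk_zero_eq (F := F) (N := N) hW)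

end Literature.MathematicalPhysics.QuantumFieldTheory.Balaban1983to89.Node00.ZeroInput

end
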